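import Literature.Geometry.Riemannian.MeanConvexSurroundingDomain
import Literature.Geometry.Riemannian.MeanConvexSurroundingProofs
import Literature.Topology.FourManifolds.EuclideanRegularDomainBoundary

/-!
# Lawson–Michelsohn (1984), Theorem 6.1 in `ℝ^{m+1}` — proof file, part 4: from the hypotheses
# of the fact to the cobordism `(D; ∅, N)` and its `1`-thinness

Topic `Geometry/Riemannian`; namespace `Literature.Geometry.Riemannian`. Continuation of
`MeanConvexSurroundingProofs.lean`, `MeanConvexSurroundingDomain.lean` (fact
`Literature.Geometry.Riemannian.LawsonMichelsohn1984_surrounding`) using the manifold-with-boundary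
structure on compact regular domains of Euclidean space
(`Literature/Topology/FourManifolds/EuclideanRegularDomain(Boundary).lean`).  Everything here
is **proved**; no statement is introduced.

The hypotheses of the fact — `F` smooth, `{F ≤ 0}` compact, `dF ≠ 0` on `{F = 0}`, `e : N → ℝ^{m+1}`
a smooth embedding of a closed connected `m`-manifold with `range e = {F = 0}`, and
`π₁({F ≤ 0}, {F = 0}) = 0` in the compression form `RelPiOneTrivial` — are turned into the
objects on which the topological half of the proof of Thm. (6.1) runs (Lawson–Michelsohn, §6:
"`D_f` is 1-thin [...] by standard handlebody theory `D_f` has a handle decomposition ..."):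

* `relPiOneTrivial_domain` — **`D` is `1`-thin**: `RelPiOneTrivial D ∂D`, transported along the
  identity `{x // F x ≤ 0} ≃ₜ h.Domain` (`IsRegularCompactDomain.subtypeHomeomorph`, which
  carries `{F = 0}` onto `∂D`) by `RelPiOneTrivial.of_image_eq` (part 1);
* `connectedSpace_domain`, `pathConnectedSpace_domain` — `D` is (path) connected, its boundary
  being the connected `e(N)` (`isConnected_setOf_nonpos_of_range_eq`, part 2); hence
  `joined_inr` — every point of `D` is joined to `N` inside `D` (the form of `H₀(D, N) = 0`
  consumed by the tree's `Cobordism.Milnor1965_cancel_index_zero`);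
* `nonempty_interior_domain` — `D` has interior points (`{F < 0} ≠ ∅`, part 2), where the small
  round ball `D₀` of the surrounding construction is placed.

## References

* H. B. Lawson, Jr., M.-L. Michelsohn, *Embedding and surrounding with positive mean curvature*,
  Invent. Math. 77 (1984), 399–419, doi:10.1007/bf01388830: §6, proof of Thm. (6.1).
  [LawsonMichelsohn1984]
-/

noncomputable section

open scoped Manifold ContDiff
open Set Literature.Topology.FourManifolds

namespace Literature.Geometry.Riemannian

variable {m : ℕ} {F : EuclideanSpace ℝ (Fin (m + 1)) → ℝ}

/-- **The domain `D` is `1`-thin**: the hypothesis `π₁({F ≤ 0}, {F = 0}) = 0` of the fact,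
moved to the manifold with boundary `D` and its boundary `∂D` (Lawson–Michelsohn's Definition,
p. 400, clause (a)). [folklore] -/
theorem relPiOneTrivial_domain (h : IsRegularCompactDomain F)
    (h1 : RelPiOneTrivial {x : EuclideanSpace ℝ (Fin (m + 1)) // F x ≤ 0} {p | F p.1 = 0}) :
    RelPiOneTrivial h.Domain ((𝓡∂ (m + 1)).boundary h.Domain) :=
  h1.of_image_eq h.subtypeHomeomorph h.image_subtypeHomeomorph

/-- **`D` is connected** when its boundary is the image of a connected `N`. [folklore] -/
theorem connectedSpace_domain (h : IsRegularCompactDomain F) {N : Type*} [TopologicalSpace N]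
    [ConnectedSpace N] {e : N → EuclideanSpace ℝ (Fin (m + 1))} (he : Continuous e)
    (hrange : range e = {x | F x = 0}) : ConnectedSpace h.Domain := by
  have h1 : IsConnected {y : EuclideanSpace ℝ (Fin (m + 1)) | F y ≤ 0} :=
    isConnected_setOf_nonpos_of_range_eq h.continuous he hrange
  have h2 : ConnectedSpace {x : EuclideanSpace ℝ (Fin (m + 1)) // F x ≤ 0} :=
    isConnected_iff_connectedSpace.1 h1
  exact h.subtypeHomeomorph.surjective.connectedSpace h.subtypeHomeomorph.continuous

/-- **`D` is path connected** when its boundary is the image of a connected `N` (a connected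
manifold with boundary is path connected). [folklore] -/
theorem pathConnectedSpace_domain (h : IsRegularCompactDomain F) {N : Type*} [TopologicalSpace N]
    [ConnectedSpace N] {e : N → EuclideanSpace ℝ (Fin (m + 1))} (he : Continuous e)
    (hrange : range e = {x | F x = 0}) : PathConnectedSpace h.Domain := by
  haveI := connectedSpace_domain h he hrange
  haveI := ChartedSpace.locallyPathConnectedSpace (EuclideanHalfSpace (m + 1)) h.Domain
  exact PathConnectedSpace.of_locallyPathConnectedSpace

/-- **Every point of `D` is joined inside `D` to a point of `N`** (`H₀(D, N) = 0`, the
hypothesis of Milnor's Thm. 8.1 Index 0 in the tree's form), for the cobordism `(D; ∅, N)` of a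
connected closed hypersurface. [folklore] -/
theorem joined_inr (hm : 1 ≤ m) (h : IsRegularCompactDomain F) {N : Type} [TopologicalSpace N]
    [ConnectedSpace N] [CompactSpace N] [ChartedSpace (EuclideanSpace ℝ (Fin m)) N]
    [IsManifold (𝓡 m) ∞ N] {e : N → EuclideanSpace ℝ (Fin (m + 1))}
    (he : Manifold.IsSmoothEmbedding (𝓡 m) 𝓘(ℝ, EuclideanSpace ℝ (Fin (m + 1))) ∞ e)
    (hrange : range e = {x | F x = 0}) (z : h.Domain) :
    ∃ x : N, Joined z ((h.cobordismOfEmbedding hm he hrange).inr x) := by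
  haveI : Nonempty N := ConnectedSpace.toNonempty
  haveI := pathConnectedSpace_domain h he.contMDiff.continuous hrange
  exact h.joined_cobordismOfEmbedding_inr hm he hrange z

/-- `D` has interior points: `{F < 0} ≠ ∅` (the round ball `D₀` of the construction is placed
there). [folklore] -/
theorem nonempty_interior_domain (h : IsRegularCompactDomain F) (hZ : {x | F x = 0}.Nonempty) :
    ((𝓡∂ (m + 1)).interior h.Domain).Nonempty := by
  obtain ⟨x, hx⟩ := setOf_neg_nonempty h.fderiv_ne_zero hZ
  exact ⟨IsRegularCompactDomain.Domain.mk h x hx.le,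
    (IsRegularCompactDomain.Domain.isInteriorPoint_iff h _).2 hx⟩

/-- **From the hypotheses of `LawsonMichelsohn1984_surrounding` to the topological data**: the
compact regular domain `D = {F ≤ 0}` as the cobordism `(D; ∅, N)` whose outgoing end is the
given hypersurface, `1`-thin, connected, with nonempty interior. [folklore] -/
theorem domainData (hm : 4 ≤ m) (N : Type) [TopologicalSpace N] [CompactSpace N]
    [ConnectedSpace N] [ChartedSpace (EuclideanSpace ℝ (Fin m)) N] [IsManifold (𝓡 m) ∞ N]
    (F : EuclideanSpace ℝ (Fin (m + 1)) → ℝ) (e : N → EuclideanSpace ℝ (Fin (m + 1)))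
    (hF : ContDiff ℝ ∞ F) (hD : IsCompact {x | F x ≤ 0}) (hreg : ∀ x, F x = 0 → fderiv ℝ F x ≠ 0)
    (he : Manifold.IsSmoothEmbedding (𝓡 m) 𝓘(ℝ, EuclideanSpace ℝ (Fin (m + 1))) ∞ e)
    (hrange : range e = {x | F x = 0})
    (h1 : RelPiOneTrivial {x : EuclideanSpace ℝ (Fin (m + 1)) // F x ≤ 0} {p | F p.1 = 0}) :
    ∃ h : IsRegularCompactDomain F,
      RelPiOneTrivial h.Domain ((𝓡∂ (m + 1)).boundary h.Domain) ∧
      PathConnectedSpace h.Domain ∧ ((𝓡∂ (m + 1)).interior h.Domain).Nonempty ∧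
      (∀ z : h.Domain, ∃ x : N,
        Joined z ((h.cobordismOfEmbedding (by omega) he hrange).inr x)) ∧
      ∀ p : N, IsRegularCompactDomain.Domain.incl h
        ((h.cobordismOfEmbedding (by omega) he hrange).inr p) = e p := by
  have h : IsRegularCompactDomain F := ⟨hF, hD, hreg⟩
  haveI : Nonempty N := ConnectedSpace.toNonempty
  have hZ : {x | F x = 0}.Nonempty := by rw [← hrange]; exact range_nonempty e
  exact ⟨h, relPiOneTrivial_domain h h1, pathConnectedSpace_domain h he.contMDiff.continuous hrange,
    nonempty_interior_domain h hZ, joined_inr (by omega) h he hrange, fun p => rfl⟩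

end Literature.Geometry.Riemannian

end
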